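import Literature.AlgebraicGeometry.Motives.AbelianVarietyVerschiebungDegree        -- ★ `kerRank_eq_of_relFrobenius_comp_eq_zsmul_id`, `isIsogeny_of_relFrobenius_comp_eq_zsmul_id`
import Literature.AlgebraicGeometry.Motives.AbelianVarietyVerschiebung              -- ★ `existsUnique_relFrobenius_one_comp_eq_zsmul_id`
import Literature.AlgebraicGeometry.Motives.AbelianVarietyFrobeniusCharpolyRigidity  -- ★ `natCard_kerPoints_le_kerRank`, `finite_kerPoints_of_isFinite`
import Literature.AlgebraicGeometry.Motives.AbelianVarietyTorsion                    -- ★ `torsionPoints_eq_kerPoints`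
import HarnessLib

/-!
# Fewer than `p^{2g}` `p`-torsion points in characteristic `p`: `#A[p](L) ≤ p^{dim A} < p^{2 dim A}`
# ([Mumford AV] §15 «the `p`-rank», p. 147; [Görtz–Wedhorn II] Prop. 27.188 (2); [EGM] (5.20)–(5.21))

Topic `Literature/AlgebraicGeometry/Motives`; namespace `Literature.AlgebraicGeometry.Motives.AbelianVariety`.  THEOREMS ONLY (no definition,
no named fact, no instance, no notation, no `sorry`).  Cell `hodgecm-mathlib` (D-0151), F0∕P6 «MOD», line L2, organ **(P-TOR)** (LEAD F0P6-plan
(g4) «M-75» (O2′) 2026-09-02T07:19:07Z; LA2-plan (g2) 07:18:27Z): the count that makes «a full level-`N` structure at a characteristic-`p` point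
with `g ≥ 1` forces `p ∤ N`» a THEOREM (consumer: the leaflet corollary `coprime_pChar_N_of_specialPoint`).  It also discharges the bound
«`p`-rank `≤ dim A`» that ★ `AbelianVarietyTorsionStructure.exists_geomTorsion_prime_pow_addEquiv_pi_zmod` records as NOT proved.
`--supports stmt-HodgeConjecture-24832`, count-neutral.  HONEST LABEL: HC_CM is proved only modulo the printed citations (2 remaining named
inputs hLiu418 24832, h413 24833) until rung 0 closes; this file is generic and discharges none of them.

## Mathematics

`k` a perfect field of characteristic `p`, `A∕k` an abelian variety of dimension `g`, `L ⊇ k` ANY field.  The multiplication `[p]_A` factors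
through the relative Frobenius: `F_{A∕k} ≫ V = [p]_A` (the Verschiebung, ★ `existsUnique_relFrobenius_one_comp_eq_zsmul_id`), and `V` is an
isogeny of degree `p^g` (★ `kerRank_eq_of_relFrobenius_comp_eq_zsmul_id`: `p^g · deg V = deg [p] = p^{2g}`).  On `L`-points, `x ↦ F(x)` maps
`A[p](L)` into `Ker V (L)` and is INJECTIVE — `F(x)` projects to `F_{Spec L}^{abs} ≫ x` (★ `comp_relFrobenius_left_comp_twistFst`) and the absolute
Frobenius of the reduced scheme `Spec L` is an epimorphism (★ `epi_powEndo`) —, while `#Ker V (L) ≤ deg V` (★ `natCard_kerPoints_le_kerRank`: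
`L`-points of a finite `k`-scheme are `L`-linearly independent algebra maps).  Hence `#A[p](L) ≤ p^g`, and `p^g < p^{2g}` as soon as `g ≥ 1`.

* §1 `map_relFrobenius_injective_of_field` — `x ↦ F_{A∕k}(x)` is injective on `L`-points for ANY field `L ⊇ k` (the tree's ★
  `AbelianVarietyFrobeniusTwistTateModule.map_relFrobenius_injective` is the case `L` perfect, by inverting `Frobⁿ_L`);
* §2 **`natCard_torsionPoints_le_pow_dim`** — `#A[p](L) ≤ p^{dim A}`; **`natCard_torsionPoints_lt_pow_two_mul_dim`** — `< p^{2 dim A}` for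
  `dim A ≥ 1`; `natCard_pow_eq_one_lt_pow_two_mul_dim` — the same for the subtype `{x : A(L) // x ^ p = 1}` (ℕ-power currency).

## References
* [MumfordAV1970] D. Mumford, *Abelian Varieties* (1970), §15 (p. 147, the `p`-rank; p. 146), §6 Application 3 (p. 64).
* [GortzWedhorn2023] U. Görtz, T. Wedhorn, *Algebraic Geometry II* (2023), Prop. 27.182 (p. 885), Prop. 27.188 (2) and Rem. 27.189 (p. 888).
* [EdixhovenVanDerGeerMoonenAV] B. Edixhoven, G. van der Geer, B. Moonen, *Abelian Varieties* (draft), Ch. 5 §2, (5.20)–(5.21).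
-/

set_option autoImplicit false

noncomputable section

universe u

open CategoryTheory CategoryTheory.Limits AlgebraicGeometry
open scoped MonObj

namespace Literature.AlgebraicGeometry.Motives.AbelianVariety

variable {k : Type u} [Field k]

/-! ## §1 The relative Frobenius is injective on points with values in a field -/

/-- **`x ↦ F^{(n)}_{A∕k}(x)` IS INJECTIVE ON `L`-POINTS** for every field `L ⊇ k` (indeed every reduced `T`; ★ `map_relFrobenius_injective` of
`AbelianVarietyFrobeniusTwistTateModule` is the perfect-`L` case): `F(x)` projects onto `A` as
`F_{Spec L}^{abs} ≫ x` (★ `comp_relFrobenius_left_comp_twistFst`), and the absolute Frobenius of a reduced scheme is an epimorphism (★ `epi_powEndo`).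
[cite: MumfordAV1970, §15 (p. 146)] [cite: GortzWedhorn2023, Prop. 27.182 (p. 885)] -/
theorem map_relFrobenius_injective_of_field (p : ℕ) [ExpChar k p] (n : ℕ) (A : AbelianVariety k) (L : Type u) [Field L] [Algebra k L] :
    Function.Injective fun x : A.Points L => (AlgPoints.map (A.relFrobenius p n).hom.hom.hom x : (A.frobeniusTwist p n).Points L) := by
  intro x y hxy
  haveI : Epi (absFrobeniusOver p n (specOver k L)) := epi_powEndo (specOver k L).left _ _ _
  have h := congrArg (fun z : (A.frobeniusTwist p n).Points L => z.left ≫ twistFst p n A.X) hxy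
  simp only [AlgPoints.map] at h
  rw [comp_relFrobenius_left_comp_twistFst, comp_relFrobenius_left_comp_twistFst, cancel_epi] at h
  exact Over.OverMorphism.ext h

/-! ## §2 `#A[p](L) ≤ p^{dim A} < p^{2 dim A}` -/

/-- **`#A[p](L) ≤ p^{dim A}` IN CHARACTERISTIC `p`** (`k` perfect of characteristic `p`, `L ⊇ k` any field): `F_{A∕k} ≫ V = [p]` with `deg V = p^{dim A}`
(★ `existsUnique_relFrobenius_one_comp_eq_zsmul_id`, ★ `kerRank_eq_of_relFrobenius_comp_eq_zsmul_id`), `x ↦ F(x)` injects `A[p](L)` into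
`Ker V (L)` (§1), and `#Ker V (L) ≤ deg V` (★ `natCard_kerPoints_le_kerRank`).  In particular the `p`-rank of `A` is at most `dim A`.
[cite: MumfordAV1970, §15 (p. 147)] [cite: GortzWedhorn2023, Prop. 27.188 (2) (p. 888)] [cite: EdixhovenVanDerGeerMoonenAV, (5.20)–(5.21)] -/
theorem natCard_torsionPoints_le_pow_dim [PerfectField k] (p : ℕ) [Fact p.Prime] [CharP k p] (A : AbelianVariety k)
    (L : Type u) [Field L] [Algebra k L] :
    Nat.card (A.torsionPoints L p) ≤ p ^ A.dim := by
  haveI : ExpChar k p := ExpChar.prime Fact.out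
  -- the Verschiebung `V` with `F ≫ V = [p]`, an isogeny of degree `p^{dim A}`
  obtain ⟨V, hV, -⟩ := A.existsUnique_relFrobenius_one_comp_eq_zsmul_id p
  have hV' : A.relFrobenius p 1 ≫ V = ((p ^ 1 : ℕ) : ℤ) • 𝟙 A := by rw [pow_one]; exact hV
  have hdeg : Hom.kerRank V = p ^ A.dim := by
    rw [A.kerRank_eq_of_relFrobenius_comp_eq_zsmul_id p 1 V hV', one_mul]
  haveI : IsFinite (Hom.toSchemeHom V) := (A.isIsogeny_of_relFrobenius_comp_eq_zsmul_id p 1 V hV').2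
  haveI : Finite (Hom.kerPoints (specOver k L) V) := finite_kerPoints_of_isFinite V L
  -- `x ↦ F(x)` : `A[p](L) → Ker V (L)`, injective
  have hmem : ∀ x : A.torsionPoints L p,
      (AlgPoints.map (A.relFrobenius p 1).hom.hom.hom (x : A.Points L) : (A.frobeniusTwist p 1).Points L) ∈
        Hom.kerPoints (specOver k L) V := by
    intro x
    have hx : (x : A.Points L) ∈ Hom.kerPoints (specOver k L) ((p : ℤ) • 𝟙 A) := by
      rw [← torsionPoints_eq_kerPoints]; exact x.2
    rw [Hom.mem_kerPoints_iff] at hx ⊢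
    have hFV : (A.relFrobenius p 1).hom.hom.hom ≫ V.hom.hom.hom = ((p : ℤ) • 𝟙 A).hom.hom.hom :=
      congrArg (fun f : A ⟶ A => f.hom.hom.hom) hV
    change ((x : A.Points L) ≫ (A.relFrobenius p 1).hom.hom.hom) ≫ V.hom.hom.hom = 1
    rw [Category.assoc, hFV]
    exact hx
  let φ : A.torsionPoints L p → Hom.kerPoints (specOver k L) V := fun x =>
    ⟨AlgPoints.map (A.relFrobenius p 1).hom.hom.hom (x : A.Points L), hmem x⟩
  have hφ : Function.Injective φ := by
    intro x y hxy
    apply Subtype.ext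
    exact map_relFrobenius_injective_of_field p 1 A L (congrArg Subtype.val hxy)
  calc Nat.card (A.torsionPoints L p) ≤ Nat.card (Hom.kerPoints (specOver k L) V) := Nat.card_le_card_of_injective φ hφ
    _ ≤ Hom.kerRank V := natCard_kerPoints_le_kerRank V L
    _ = p ^ A.dim := hdeg

/-- **`#A[p](L) < p^{2 dim A}` IN CHARACTERISTIC `p` FOR `dim A ≥ 1`** (from `≤ p^{dim A}` and `p ≥ 2`): there are NOT `p^{2g}` `p`-torsion points,
so no full level-`N` structure with `p ∣ N` exists at a characteristic-`p` point — the (P-TOR) input of the leaflet corollary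
`coprime_pChar_N_of_specialPoint` (line L2, «M-75»). [cite: MumfordAV1970, §15 (p. 147)] [cite: GortzWedhorn2023, Prop. 27.188 (2) (p. 888)] -/
theorem natCard_torsionPoints_lt_pow_two_mul_dim [PerfectField k] (p : ℕ) [Fact p.Prime] [CharP k p] (A : AbelianVariety k)
    (L : Type u) [Field L] [Algebra k L] (hA : 0 < A.dim) :
    Nat.card (A.torsionPoints L p) < p ^ (2 * A.dim) :=
  lt_of_le_of_lt (natCard_torsionPoints_le_pow_dim p A L)
    (Nat.pow_lt_pow_right (Fact.out : p.Prime).one_lt (by omega))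

/-- The same count in the ℕ-power currency of `A.Points L` (`x ^ p = 1`; ★ `mem_torsionPoints_iff` is the `ℤ`-power `x ^ (p : ℤ) = 1`):
`#{x ∈ A(L) | x^p = 1} < p^{2 dim A}` for `dim A ≥ 1`. [cite: MumfordAV1970, §15 (p. 147)] [cite: GortzWedhorn2023, Prop. 27.188 (2) (p. 888)] -/
theorem natCard_pow_eq_one_lt_pow_two_mul_dim [PerfectField k] (p : ℕ) [Fact p.Prime] [CharP k p] (A : AbelianVariety k)
    (L : Type u) [Field L] [Algebra k L] (hA : 0 < A.dim) :
    Nat.card {x : A.Points L // x ^ p = 1} < p ^ (2 * A.dim) := by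
  have e : {x : A.Points L // x ^ p = 1} ≃ A.torsionPoints L p :=
    { toFun := fun x => ⟨x.1, by rw [mem_torsionPoints_iff, zpow_natCast]; exact x.2⟩
      invFun := fun x => ⟨x.1, by have h := x.2; rw [mem_torsionPoints_iff, zpow_natCast] at h; exact h⟩
      left_inv := fun x => rfl
      right_inv := fun x => rfl }
  rw [Nat.card_congr e]
  exact natCard_torsionPoints_lt_pow_two_mul_dim p A L hA

end Literature.AlgebraicGeometry.Motives.AbelianVariety

end
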